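import Mathlib.Topology.Instances.AddCircle.Real
import Mathlib.Analysis.Normed.Group.AddCircle
import Mathlib.FieldTheory.Finite.Basic
import Mathlib.Data.Real.Basic
import Mathlib.Tactic
import HarnessLib

/-!
# Route `GreenTaoLevelTwo`, crux `GITwo` (stmt-Parity-21275), line `birth`, stub `stub_cyclicInverse`:
# a separating set of frequencies in `ℤ/Nℤ`, `N` prime (qualitative arXiv Lemma 37)

Fourteenth helper file toward the XL stub `stub_cyclicInverse` (B. Green, T. Tao, arXiv:math/0503014,
Thm. 68 = PEMS 51 (2008) Thm. 12.8).  arXiv Lemma 37 (separation lemma) supplies, for a finite set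
`A` of frequencies, a set `S` with `A ∩ B(S, ¼) = {0}`; GT08a gets `|S| ≤ 1 + 2 log₂|A|` by a random
choice.  For the REGISTERED stub (constants may depend on `η` arbitrarily) the qualitative version
suffices, and in `ℤ/Nℤ` with `N` prime it is explicit: `s_ξ = ξ⁻¹ · ⌊N/2⌋` has `‖ξ s_ξ / N‖_{ℝ/ℤ} =
⌊N/2⌋/N ≥ ¼`.  This def-free file lands it (Bohr conditions via `ZMod.toAddCircle`), completing —
with `…GraphFibre`, `…TorusBoxes`, `…GraphSlice` — the ingredients of arXiv Lemma 44 over `ℤ/Nℤ`: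

* `norm_toAddCircle_half` — `‖toAddCircle(⌊N/2⌋)‖ = ⌊N/2⌋/N ≥ ¼` (`N ≥ 2`);
* `exists_separating_set` — **separation at radius ¼**: for `N` prime and `A ⊆ ℤ/Nℤ` there is `S`
  with `#S ≤ #A` such that every nonzero `ξ ∈ A` has some `s ∈ S` with `‖toAddCircle(ξ s)‖ ≥ ¼`
  (so `A ∩ B(S, ¼) ⊆ {0}`; size `#A` instead of the printed `1 + 2log₂#A`, which only affects constants).

References: [GreenTao2008U3Inverse] arXiv:math/0503014, Lemma 37 (statement; this is the trivial
deterministic variant) and Lemma 44 (use).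
-/

namespace Summit.Parity.GeneralizedHardyLittlewood.GreenTaoLevelTwoGITwoCyclicInverse

open Finset

variable {N : ℕ} [NeZero N]

/-- The residue `⌊N/2⌋` is far from `0` on the circle: `‖toAddCircle(⌊N/2⌋)‖ = ⌊N/2⌋/N`. [folklore] -/
theorem norm_toAddCircle_half : ‖ZMod.toAddCircle (((N / 2 : ℕ) : ZMod N))‖ = ((N / 2 : ℕ) : ℝ) / N := by
  have hN : 0 < N := Nat.pos_of_ne_zero (NeZero.ne N)
  rw [ZMod.toAddCircle_natCast, UnitAddCircle.norm_eq, abs_sub_round_div_natCast_eq]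
  congr 1
  have h1 : N / 2 % N = N / 2 := Nat.mod_eq_of_lt (Nat.div_lt_self hN one_lt_two)
  rw [h1]
  norm_cast
  exact min_eq_left (by omega)

omit [NeZero N] in
/-- `⌊N/2⌋/N ≥ ¼` for `N ≥ 2`. [folklore] -/
theorem quarter_le_half_div (hN : 2 ≤ N) : (1 : ℝ) / 4 ≤ ((N / 2 : ℕ) : ℝ) / N := by
  have hNr : (0 : ℝ) < N := by exact_mod_cast (lt_of_lt_of_le two_pos hN)
  rw [div_le_div_iff₀ (by norm_num) hNr, one_mul]
  have h : (N : ℝ) ≤ ((N / 2 : ℕ) : ℝ) * 2 + 1 := by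
    have h3 : N ≤ N / 2 * 2 + 1 := by
      have := Nat.div_add_mod N 2
      have hm := Nat.mod_lt N two_pos
      omega
    exact_mod_cast h3
  have h2r : (2 : ℝ) ≤ N := by exact_mod_cast hN
  nlinarith

/-- **Separation at radius `¼` (qualitative GT08a arXiv Lemma 37) in `ℤ/Nℤ`, `N` prime.** For every
finite `A ⊆ ℤ/Nℤ` there is `S` with `#S ≤ #A` such that every nonzero `ξ ∈ A` has a witness `s ∈ S`
with `‖toAddCircle(ξ s)‖ ≥ ¼`; i.e. `A ∩ B(S, ¼) ⊆ {0}`. [cite: GreenTao2008U3Inverse, Lemma 37] -/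
theorem exists_separating_set (hN : N.Prime) (A : Finset (ZMod N)) :
    ∃ S : Finset (ZMod N), #S ≤ #A ∧
      ∀ ξ ∈ A, ξ ≠ 0 → ∃ s ∈ S, (1 : ℝ) / 4 ≤ ‖ZMod.toAddCircle (ξ * s)‖ := by
  classical
  haveI : Fact N.Prime := ⟨hN⟩
  refine ⟨(A.erase 0).image fun ξ => ξ⁻¹ * ((N / 2 : ℕ) : ZMod N),
    (card_image_le.trans (card_erase_le)), fun ξ hξ hξ0 => ?_⟩
  refine ⟨ξ⁻¹ * ((N / 2 : ℕ) : ZMod N), mem_image_of_mem _ (mem_erase.mpr ⟨hξ0, hξ⟩), ?_⟩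
  rw [← mul_assoc, mul_inv_cancel₀ hξ0, one_mul, norm_toAddCircle_half]
  exact quarter_le_half_div hN.two_le

/-- The separation property in the form used by `injOn_fst_four_sub_four` (file `…GraphSlice`):
no nonzero `ξ ∈ A` has all `‖toAddCircle(ξ s)‖ < ¼`, `s ∈ S`. [cite: GreenTao2008U3Inverse, Lemma 37] -/
theorem exists_separating_set' (hN : N.Prime) (A : Finset (ZMod N)) :
    ∃ S : Finset (ZMod N), #S ≤ #A ∧
      ∀ ξ ∈ A, (∀ s ∈ S, ‖ZMod.toAddCircle (ξ * s)‖ < 1 / 4) → ξ = 0 := by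
  obtain ⟨S, hS, h⟩ := exists_separating_set hN A
  refine ⟨S, hS, fun ξ hξ hsmall => ?_⟩
  by_contra hξ0
  obtain ⟨s, hs, hle⟩ := h ξ hξ hξ0
  exact absurd (hsmall s hs) (not_lt.mpr hle)

end Summit.Parity.GeneralizedHardyLittlewood.GreenTaoLevelTwoGITwoCyclicInverse
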